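import Mathlib
import Summits.NavierStokesRegularity.FluidComputer.TorusHighBandCeilingFlow
import Literature.Analysis.FluidPDE.LerayHopfSpectralMeasurability
import HarnessLib

/-!
# The high-band ceiling in the LIONS energy-equality class of Leray–Hopf solutions (`T^d`, `2 ≤ d ≤ 4`)

HONEST FRAMING (cell `ns-blowup`, seat `ns-blowup-circuit` g6, human ruling D-0035): nothing here is a
claim about Navier–Stokes blow-up. WHAT THIS IS NOT: not a regularity criterion, not blow-up evidence.
Part 6 of the `TorusHighBand*` files: the continuity hypothesis of `highBand_ceiling` (p446381) is
DISCHARGED for every Leray–Hopf solution of the periodic Navier–Stokes equations in the Lions class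
`u ∈ L⁴(0,T; L⁴(T^d))`, `2 ≤ d ≤ 4` (all two-dimensional Leray–Hopf flows; all three-dimensional
strong solutions), with `u(0) = u₀ ∈ L²` and `f ∈ L¹(0,T;L²)`: by the tree's Lions–Shinbrot energy
EQUALITY `Torus.lions_energy_equality_Ioc` (`FluidPDE/DuchonRobertLionsEnergyEquality`) the energy is a
primitive of integrable functions, hence continuous on `[0,T]`, and so is the truncated energy
`‖P_M u(t)‖²` (the level-`M` identity); therefore `t ↦ ½‖Q_M u(t)‖²` is continuous and the ceiling and
its contrapositive hold: `highBand_ceiling_lions`, `lowStrain_large_of_highBand_growth_lions`.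
No definitions.
-/

noncomputable section

open MeasureTheory Set Filter UnitAddTorus Function
open scoped ENNReal NNReal InnerProductSpace RealInnerProductSpace Topology

namespace Summit.NavierStokesRegularity.FluidComputer.TorusHighBandFluxCeiling

open Literature.Analysis Literature.Analysis.FunctionSpaces Literature.Analysis.FluidPDE

variable {d : Type*} [Fintype d] [DecidableEq d]

section Lions

variable {T ν : ℝ} {f u : ℝ → UnitAddTorus d → EuclideanSpace ℝ d}

/-- **Continuity of the energy in the Lions class.** For a Leray–Hopf solution with `u(0) ∈ L²` as
datum, `u ∈ L⁴(0,T;L⁴)`, `2 ≤ d ≤ 4`, jointly measurable `f ∈ L¹(0,T;L²)`: `t ↦ ½‖u(t)‖²` is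
continuous on `[0,T]` (energy equality: a constant plus primitives of integrable functions). [folklore] -/
theorem continuousOn_kineticEnergy_lions (hd2 : 2 ≤ Fintype.card d) (hd4 : Fintype.card d ≤ 4)
    (hu : FluidPDE.Torus.IsLerayHopfOn T ν f (u 0) u) (hT : 0 < T)
    (hu4 : FluidPDE.Torus.MemLqLp 4 4 u (Ioo 0 T))
    (hfm : AEStronglyMeasurable (Torus.stLift f) (volume.restrict (Ioo 0 T ×ˢ univ)))
    (hf : FluidPDE.Torus.MemLqLp 1 2 f (Ioo 0 T)) :
    ContinuousOn (fun t => Torus.kineticEnergy (u t)) (Icc 0 T) := by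
  have hu0 : MemLp (u 0) 2 volume := hu.memLp 0 ⟨le_rfl, hT.le⟩
  -- the work and the dissipation as primitives on `[0, T]`
  have hW : IntegrableOn (fun s => ∫ x, ⟪f s x, u s x⟫) (Icc 0 T) := by
    have h := FluidPDE.Torus.WeakNSEnergyClass.integrableOn_work_L1L2 hu.weak hu.energy_bound
      hu.memLp hfm hf
    exact (integrableOn_Icc_iff_integrableOn_Ioo (by finiteness) (by finiteness)).2 h
  have hDm : AEMeasurable (fun s => Torus.eGradNormSq (u s)) (volume.restrict (Ioo 0 T)) :=
    hu.aemeasurable_eGradNormSq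
  have hDfin : ∫⁻ s in Ioo 0 T, Torus.eGradNormSq (u s) ≠ ⊤ := hu.lintegral_eGradNormSq_lt_top.ne
  have hD : IntegrableOn (fun s => (Torus.eGradNormSq (u s)).toReal) (Icc 0 T) := by
    have h : IntegrableOn (fun s => (Torus.eGradNormSq (u s)).toReal) (Ioo 0 T) :=
      integrable_toReal_of_lintegral_ne_top hDm hDfin
    exact (integrableOn_Icc_iff_integrableOn_Ioo (by finiteness) (by finiteness)).2 h
  have hcW := intervalIntegral.continuousOn_primitive_interval (μ := volume)
    (f := fun s => ∫ x, ⟪f s x, u s x⟫) (a := 0) (b := T) (by rwa [uIcc_of_le hT.le])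
  have hcD := intervalIntegral.continuousOn_primitive (μ := volume) hD
  rw [uIcc_of_le hT.le] at hcW
  -- the energy equality, written for every `t ∈ [0, T]`
  have hrepr : EqOn (fun t => Torus.kineticEnergy (u t))
      (fun t => Torus.kineticEnergy (u 0) + (∫ τ in (0 : ℝ)..t, ∫ x, ⟪f τ x, u τ x⟫) -
        ν * ∫ s in Ioc 0 t, (Torus.eGradNormSq (u s)).toReal) (Icc 0 T) := by
    intro t ht
    rcases eq_or_lt_of_le ht.1 with h0 | h0
    · subst h0; simp
    · have hE := FluidPDE.lions_energy_equality_Ioc hd2 hd4 hu hu0 hu4 hfm hf t ⟨h0, ht.2⟩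
      have hle : volume.restrict (Ioo 0 t) ≤ volume.restrict (Ioo 0 T) :=
        Measure.restrict_mono (Ioo_subset_Ioo le_rfl ht.2) le_rfl
      have hfinN : ∀ᵐ s ∂(volume.restrict (Ioo 0 t)), Torus.eGradNormSq (u s) < ⊤ := by
        have h1 : ∀ᵐ s ∂(volume.restrict (Ioo 0 T)), Torus.eGradNormSq (u s) < ⊤ :=
          ae_lt_top' hDm hDfin
        exact ae_mono hle h1
      have hP : (∫⁻ s in Ioo 0 t, Torus.eGradNormSq (u s)).toReal =
          ∫ s in Ioc 0 t, (Torus.eGradNormSq (u s)).toReal := by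
        rw [← integral_toReal (hDm.mono_measure hle) hfinN, setIntegral_congr_set Ioo_ae_eq_Ioc]
      rw [hP] at hE
      dsimp only
      linarith
  exact ContinuousOn.congr (continuousOn_const.add hcW |>.sub (continuousOn_const.mul hcD)) hrepr

/-- **Continuity of the truncated energy** `t ↦ ∫⟪P_M u(t), P_M u(t)⟫` on `[0,T]` for a Leray–Hopf
solution with datum `u(0) ∈ L²` and `f ∈ L¹(0,T;L²)` (the level-`M` identity
`Torus.IsLerayHopfOn.integral_inner_fourierTruncate_self_eq`: a constant plus a primitive). [folklore] -/
theorem continuousOn_truncEnergy_of_lerayHopf (hu : FluidPDE.Torus.IsLerayHopfOn T ν f (u 0) u)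
    (hT : 0 < T) (hfm : AEStronglyMeasurable (Torus.stLift f) (volume.restrict (Ioo 0 T ×ˢ univ)))
    (hf : FluidPDE.Torus.MemLqLp 1 2 f (Ioo 0 T)) (M : ℕ) :
    ContinuousOn (fun t => ∫ x, ⟪Torus.fourierTruncate M (u t) x, Torus.fourierTruncate M (u t) x⟫)
      (Icc 0 T) := by
  have hu0 : MemLp (u 0) 2 volume := hu.memLp 0 ⟨le_rfl, hT.le⟩
  set Φ : ℝ → ℝ := fun s => ∫ x, (⟪u s x, Torus.convect (u s) (Torus.fourierTruncate M (u s)) x⟫ +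
      ν * ⟪u s x, Torus.laplacian (Torus.fourierTruncate M (u s)) x⟫ +
      ⟪f s x, Torus.fourierTruncate M (u s) x⟫) with hΦ
  have hΦT : IntegrableOn Φ (Icc 0 T) := by
    have h := (hu.integral_inner_fourierTruncate_self_eq hT hfm hf hu0 M ⟨hT, le_rfl⟩).1
    exact (integrableOn_Icc_iff_integrableOn_Ioc (by finiteness)).2 h
  have hc := intervalIntegral.continuousOn_primitive (μ := volume) hΦT
  have hrepr : EqOn (fun t => ∫ x, ⟪Torus.fourierTruncate M (u t) x, Torus.fourierTruncate M (u t) x⟫)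
      (fun t => (∫ x, ⟪Torus.fourierTruncate M (u 0) x, Torus.fourierTruncate M (u 0) x⟫) +
        2 * ∫ s in Ioc 0 t, Φ s) (Icc 0 T) := by
    intro t ht
    rcases eq_or_lt_of_le ht.1 with h0 | h0
    · subst h0; simp
    · exact (hu.integral_inner_fourierTruncate_self_eq hT hfm hf hu0 M ⟨h0, ht.2⟩).2
  exact ContinuousOn.congr (continuousOn_const.add (continuousOn_const.mul hc)) hrepr

/-- **Continuity of the high-band energy in the Lions class**: `t ↦ ½‖Q_M u(t)‖²` is continuous on
`[0,T]` (Pythagoras `kineticEnergy_highBand_eq` + the two continuity lemmas). [folklore] -/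
theorem continuousOn_highBand_energy_lions (hd2 : 2 ≤ Fintype.card d) (hd4 : Fintype.card d ≤ 4)
    (hu : FluidPDE.Torus.IsLerayHopfOn T ν f (u 0) u) (hT : 0 < T)
    (hu4 : FluidPDE.Torus.MemLqLp 4 4 u (Ioo 0 T))
    (hfm : AEStronglyMeasurable (Torus.stLift f) (volume.restrict (Ioo 0 T ×ˢ univ)))
    (hf : FluidPDE.Torus.MemLqLp 1 2 f (Ioo 0 T)) (M : ℕ) :
    ContinuousOn (fun s => Torus.kineticEnergy (u s - Torus.fourierTruncate M (u s))) (Icc 0 T) := by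
  have h1 := continuousOn_kineticEnergy_lions hd2 hd4 hu hT hu4 hfm hf
  have h2 := continuousOn_truncEnergy_of_lerayHopf hu hT hfm hf M
  have hrepr : EqOn (fun s => Torus.kineticEnergy (u s - Torus.fourierTruncate M (u s)))
      (fun s => Torus.kineticEnergy (u s) -
        2⁻¹ * ∫ x, ⟪Torus.fourierTruncate M (u s) x, Torus.fourierTruncate M (u s) x⟫) (Icc 0 T) :=
    fun s hs => kineticEnergy_highBand_eq (hu.memLp s hs) M
  exact ContinuousOn.congr (h1.sub (continuousOn_const.mul h2)) hrepr

/-- **THE HIGH-BAND CEILING IN THE LIONS CLASS.** Let `u` be a Leray–Hopf solution of the periodic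
Navier–Stokes equations on `T^d × [0,T)`, `2 ≤ d ≤ 4`, with datum `u(0)`, `T > 0`, `ν > 0`,
`u ∈ L⁴(0,T;L⁴)`, jointly measurable `f ∈ L¹(0,T;L²)`; let `M` be a band edge and `G` a level with
`K_M(u(s))‖u(s)‖₂ + ‖f(s)‖₂ ≤ G` for a.e. `s ∈ (0,T)`. Then for all `t ∈ [0,T]`,
`‖Q_M u(t)‖₂ ≤ max(‖Q_M u(0)‖₂, G/(4π²ν(M²+1)))`. [folklore] -/
theorem highBand_ceiling_lions (hd2 : 2 ≤ Fintype.card d) (hd4 : Fintype.card d ≤ 4)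
    (hu : FluidPDE.Torus.IsLerayHopfOn T ν f (u 0) u) (hT : 0 < T)
    (hu4 : FluidPDE.Torus.MemLqLp 4 4 u (Ioo 0 T))
    (hfm : AEStronglyMeasurable (Torus.stLift f) (volume.restrict (Ioo 0 T ×ˢ univ)))
    (hf : FluidPDE.Torus.MemLqLp 1 2 f (Ioo 0 T)) (hν : 0 < ν) (M : ℕ) {G : ℝ}
    (hG : ∀ᵐ s ∂(volume.restrict (Ioo 0 T)),
      FluidPDE.Torus.truncDerivBound M (u s) * Real.sqrt (∫ x, ‖u s x‖ ^ 2) +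
        Real.sqrt (∫ x, ‖f s x‖ ^ 2) ≤ G) :
    ∀ t ∈ Icc 0 T, Real.sqrt (2 * Torus.kineticEnergy (u t - Torus.fourierTruncate M (u t))) ≤
      max (Real.sqrt (2 * Torus.kineticEnergy (u 0 - Torus.fourierTruncate M (u 0))))
        (G / (4 * Real.pi ^ 2 * ν * ((M : ℝ) ^ 2 + 1))) :=
  highBand_ceiling hu hT hfm hf hν M hG (continuousOn_highBand_energy_lions hd2 hd4 hu hT hu4 hfm hf M)

/-- **Contrapositive in the Lions class — the coherence law for periodic Navier–Stokes.** In the setting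
of `highBand_ceiling_lions`: if `‖Q_M u(t)‖₂ > max(‖Q_M u(0)‖₂, X)` at some `t ∈ [0,T]`, then
`∃ᵐ s ∈ (0,T)`, `4π²ν(M²+1)·X < K_M(u(s))‖u(s)‖₂ + ‖f(s)‖₂`. [folklore] -/
theorem lowStrain_large_of_highBand_growth_lions (hd2 : 2 ≤ Fintype.card d) (hd4 : Fintype.card d ≤ 4)
    (hu : FluidPDE.Torus.IsLerayHopfOn T ν f (u 0) u) (hT : 0 < T)
    (hu4 : FluidPDE.Torus.MemLqLp 4 4 u (Ioo 0 T))
    (hfm : AEStronglyMeasurable (Torus.stLift f) (volume.restrict (Ioo 0 T ×ˢ univ)))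
    (hf : FluidPDE.Torus.MemLqLp 1 2 f (Ioo 0 T)) (hν : 0 < ν) (M : ℕ) {X t : ℝ} (ht : t ∈ Icc 0 T)
    (hgrow : max (Real.sqrt (2 * Torus.kineticEnergy (u 0 - Torus.fourierTruncate M (u 0)))) X <
      Real.sqrt (2 * Torus.kineticEnergy (u t - Torus.fourierTruncate M (u t)))) :
    ∃ᵐ s ∂(volume.restrict (Ioo 0 T)),
      4 * Real.pi ^ 2 * ν * ((M : ℝ) ^ 2 + 1) * X <
        FluidPDE.Torus.truncDerivBound M (u s) * Real.sqrt (∫ x, ‖u s x‖ ^ 2) +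
          Real.sqrt (∫ x, ‖f s x‖ ^ 2) :=
  lowStrain_large_of_highBand_growth hu hT hfm hf hν M
    (continuousOn_highBand_energy_lions hd2 hd4 hu hT hu4 hfm hf M) ht hgrow

end Lions

end Summit.NavierStokesRegularity.FluidComputer.TorusHighBandFluxCeiling
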